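import Mathlib.NumberTheory.LSeries.DirichletContinuation
import Mathlib.NumberTheory.LSeries.Nonvanishing
import Mathlib.NumberTheory.EulerProduct.DirichletLSeries
import Mathlib.Analysis.Calculus.Deriv.Star
import Mathlib.Analysis.SpecialFunctions.Complex.LogBounds
import Mathlib.NumberTheory.ArithmeticFunction.VonMangoldt
import Mathlib.Data.Nat.Factorization.PrimePow
import Literature.NumberTheory.LFunctions.SelbergClass
import Literature.NumberTheory.LFunctions.SiegelAbelSummation
import Literature.NumberTheory.LFunctions.RiemannXiOrderProofs
import HarnessLib

/-!
# Primitive Dirichlet `L`-functions lie in the Selberg class (discharge of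
`exists_selbergDatum_LFunction` and `SelbergGrandRiemannHypothesis.lFunction_re_eq_one_half`)

Sibling proofs file (D-0014 append protocol) for
`Literature/NumberTheory/LFunctions/SelbergClass.lean`. Everything here is PROVED (no `sorry`,
no new definitions). Main results:

* `Literature.exists_selbergDatum_LFunction_holds : exists_selbergDatum_LFunction` — for a primitive
  Dirichlet character `χ` mod `N > 1`, `L(s, χ)` underlies a Selberg datum of degree `1` with no
  pole (Kaczorowski–Perelli survey §1, Example "Dirichlet `L`-functions"; Montgomery–Vaughan
  Cor. 10.8): `a(n) = χ(n)`, `m = 0`, `Q = (N/π)^{1/2}`, one gamma factor `Γ(s/2 + κ/2)`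
  (`κ ∈ {0, 1}` the parity of `χ`), `ω = ε(χ) = τ(χ)/(i^κ √N)` (Mathlib's
  `DirichletCharacter.rootNumber`), `b(n) = χ(n) Λ(n)/log n`, `θ = 0`.
* `Literature.NumberTheory.LFunctions.SelbergGrandRiemannHypothesis.lFunction_re_eq_one_half_holds` — hence the Grand Riemann
  Hypothesis for `𝒮` gives the strip-form Riemann hypothesis for `L(s, χ)` (three lines over the
  previous result; this is the interim proof preserved in `SelbergClass.lean`).

## The verification of Selberg's axioms and its sources

* (i) Ramanujan `|χ(n)| ≤ 1`; Dirichlet series `LFunction_eq_LSeries` (Mathlib).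
* (ii) `L(s, χ)` is entire (Mathlib `differentiable_LFunction`, `χ ≠ 1` as `N > 1`) **of finite
  order**: `Literature.NumberTheory.LFunctions.SelbergDirichlet.exists_norm_LFunction_le_exp_rpow`,
  `‖L(s, χ)‖ ≤ A exp(‖s‖³)`. Montgomery–Vaughan obtain (10.31) `ξ(s, χ) ≪ exp(|s| log q|s|)`
  from Stirling's formula; we avoid Stirling: on `re s ≥ 1/2` partial summation gives
  `‖L(s, χ)‖ ≤ N ‖s‖ ∑ n^{-σ-1}` (`Literature.NumberTheory.LFunctions.DirichletAbel.norm_LFunction_le`, Montgomery–Vaughan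
  §4.3 (4.22)–(4.23)), and on `re s < 1/2` the functional equation together with Euler's
  reflection formula `1/Γ(z) = Γ(1-z) sin(πz)/π`, `|Γ(w)| ≤ Γ(re w) ≤ 4 + e^{x log(1+x)}`
  (`Literature.NumberTheory.LFunctions.norm_Gamma_le_Gamma_re`, `Literature.NumberTheory.LFunctions.Real.Gamma_le_of_quarter_le`) and `|sin z| ≤ e^{|z|}`
  reduce to the first case (the shape of Montgomery–Vaughan Cor. 10.10).
* (iii) functional equation `Φ(s) = ω conj Φ(1 - conj s)` on the strip
  (`Literature.NumberTheory.LFunctions.SelbergDirichlet.functional_equation_selberg`): Mathlib's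
  `DirichletCharacter.IsPrimitive.completedLFunction_one_sub`
  (`Λ(1-s, χ) = N^{s-1/2} ε(χ) Λ(s, χ̄)`, Montgomery–Vaughan Cor. 10.8) combined with the
  conjugation symmetry `conj Λ(conj s, χ) = Λ(s, χ̄)` (`completedLFunction_conj`, identity theorem
  from `re s > 1`) and `Q^s Γ(s/2+κ/2) L(s, χ) = π^{κ/2} N^{s/2} Λ(s, χ)` (`selbergPhi_eq`);
  `‖ε(χ)‖ = 1` (`norm_rootNumber`) from `τ(χ) conj τ(χ) = N` for primitive `χ` to ANY modulus
  (`gaussSum_mul_conj_of_isPrimitive`, Montgomery–Vaughan Thm. 9.7; Mathlib's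
  `gaussSum_mul_gaussSum_eq_card` covers prime moduli only).
* (v) Euler product in logarithmic form (`exp_LSeries_vonMangoldt_div_log_eq`):
  `exp(∑ χ(n)Λ(n)/log n · n^{-s}) = L(s, χ)` on `re s > 1`, from Mathlib's
  `DirichletCharacter.LSeries_eulerProduct_exp_log` and `-log(1-z) = ∑ z^k/k`, reindexing prime
  powers through `Nat.Primes.prodNatEquiv` (Montgomery–Vaughan §1.3).

The character-theoretic lemmas (parity of `χ⁻¹`, conjugation symmetry, `|τ(χ)|² = N`,
`‖ε(χ)‖ = 1`) are adapted from the prior-programme stockroom file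
`Rh_DebrangesReplacementPositivity_DbrpCstarChi` (same toolchain), with proofs unchanged.

## References

* J. Kaczorowski, A. Perelli, *The Selberg class: a survey*, in: Number Theory in Progress,
  de Gruyter 1999, 953–992, §1. [KaczorowskiPerelli1999]
* H. L. Montgomery, R. C. Vaughan, *Multiplicative Number Theory I. Classical Theory*, Cambridge
  2007: Thm. 9.7 (`|τ(χ)| = √q`), (10.17) (`ε(χ)`, `|ε(χ)| = 1`), Cor. 10.8 (functional
  equation), Cor. 10.10, (10.31) (order `1`), §4.3 (4.22)–(4.23). [MontgomeryVaughan2007]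
* H. Davenport, *Multiplicative Number Theory*, 2nd ed., GTM 74, Springer 1980, Ch. 9.
  [DavenportMNT1980]
-/

noncomputable section

open Complex Filter Topology Set DirichletCharacter
open scoped ComplexConjugate Real

namespace Literature.NumberTheory.LFunctions

namespace SelbergDirichlet

variable {N : ℕ} [NeZero N]

/-! ### Dirichlet characters: parity, inverse, primitivity -/

omit [NeZero N] in
/-- The inverse (= complex conjugate) character has the same parity. [folklore] -/
lemma even_inv_iff (χ : DirichletCharacter ℂ N) : χ⁻¹.Even ↔ χ.Even := by
  unfold DirichletCharacter.Even
  rw [MulChar.inv_apply_eq_inv']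
  constructor
  · intro h
    rw [← inv_inv (χ (-1)), h, inv_one]
  · intro h
    rw [h, inv_one]

omit [NeZero N] in
/-- The Archimedean gamma factor depends only on the parity, hence agrees for `χ` and `χ⁻¹`.
[folklore] -/
lemma gammaFactor_inv (χ : DirichletCharacter ℂ N) (s : ℂ) :
    gammaFactor χ⁻¹ s = gammaFactor χ s := by
  rcases χ.even_or_odd with h | h
  · rw [h.gammaFactor_def, (DirichletCharacter.Even.gammaFactor_def ((even_inv_iff χ).2 h))]
  · have h' : χ⁻¹.Odd := by
      unfold DirichletCharacter.Odd at h ⊢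
      rw [MulChar.inv_apply_eq_inv', h]
      norm_num
    rw [h.gammaFactor_def, h'.gammaFactor_def]

omit [NeZero N] in
/-- The gamma factor has no zero (Mathlib convention: no pole) on `re s > 0`. [folklore] -/
lemma gammaFactor_ne_zero_of_re_pos (χ : DirichletCharacter ℂ N) {s : ℂ} (hs : 0 < s.re) :
    gammaFactor χ s ≠ 0 := by
  rcases χ.even_or_odd with h | h
  · rw [h.gammaFactor_def]
    exact Complex.Gammaℝ_ne_zero_of_re_pos hs
  · rw [h.gammaFactor_def]
    refine Complex.Gammaℝ_ne_zero_of_re_pos ?_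
    rw [Complex.add_re, Complex.one_re]
    linarith

/-- `Γ_ℝ(conj s) = conj Γ_ℝ(s)`. [folklore] -/
lemma Gammaℝ_conj (s : ℂ) : Complex.Gammaℝ (conj s) = conj (Complex.Gammaℝ s) := by
  rw [Complex.Gammaℝ_def, Complex.Gammaℝ_def, map_mul]
  congr 1
  · have h2 : -(conj s) / 2 = conj (-s / 2) := by
      simp [map_div₀, map_ofNat]
    rw [h2, Complex.cpow_conj _ _ (by
      rw [Complex.arg_ofReal_of_nonneg Real.pi_pos.le]
      exact Real.pi_ne_zero.symm), Complex.conj_ofReal]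
  · rw [← Complex.Gamma_conj]
    congr 1
    simp [map_div₀, map_ofNat]

omit [NeZero N] in
/-- `gammaFactor χ (conj s) = conj (gammaFactor χ s)`. [folklore] -/
lemma gammaFactor_conj (χ : DirichletCharacter ℂ N) (s : ℂ) :
    gammaFactor χ (conj s) = conj (gammaFactor χ s) := by
  rcases χ.even_or_odd with h | h
  · rw [h.gammaFactor_def, h.gammaFactor_def, Gammaℝ_conj]
  · rw [h.gammaFactor_def, h.gammaFactor_def, ← Gammaℝ_conj]
    congr 1
    rw [map_add, map_one]

omit [NeZero N] in
/-- Primitivity passes to the inverse (= conjugate) character (same conductor,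
Mathlib `conductor_inv`). [folklore] -/
lemma isPrimitive_inv {χ : DirichletCharacter ℂ N} (hχ : IsPrimitive χ) : IsPrimitive χ⁻¹ := by
  unfold IsPrimitive at hχ ⊢
  rw [conductor_inv]
  exact hχ

/-- A primitive character to a modulus `N ≠ 1` is non-trivial (the trivial character has
conductor `1`). [folklore] -/
lemma ne_one_of_isPrimitive (hN : N ≠ 1) {χ : DirichletCharacter ℂ N} (hχ : IsPrimitive χ) :
    χ ≠ 1 := by
  intro h
  rw [eq_one_iff_conductor_eq_one] at h
  unfold IsPrimitive at hχ
  rw [hχ] at h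
  exact hN h

/-! ### Conjugation symmetry `conj L(conj s, χ) = L(s, χ̄)` -/

/-- Conjugation symmetry of the Dirichlet series on `re s > 1`:
`conj L(conj s, χ) = L(s, χ⁻¹)` (`χ⁻¹ = χ̄` pointwise, `MulChar.star_apply'`)
(Davenport, *Multiplicative Number Theory*, Ch. 9; immediate from the series). [folklore] -/
lemma LFunction_conj_of_one_lt_re (χ : DirichletCharacter ℂ N) {s : ℂ} (hs : 1 < s.re) :
    conj (LFunction χ (conj s)) = LFunction χ⁻¹ s := by
  have hs' : 1 < (conj s).re := by rwa [Complex.conj_re]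
  rw [LFunction_eq_LSeries χ hs', LFunction_eq_LSeries χ⁻¹ hs, LSeries, LSeries]
  rw [show (conj (∑' n, LSeries.term (fun n => χ n) (conj s) n))
      = ∑' n, conj (LSeries.term (fun n => χ n) (conj s) n) from tsum_star]
  congr 1
  funext n
  rcases eq_or_ne n 0 with rfl | hn
  · simp [LSeries.term]
  · rw [LSeries.term_of_ne_zero hn, LSeries.term_of_ne_zero hn, map_div₀]
    congr 1
    · exact MulChar.star_apply' χ (n : ZMod N)
    · have hn' : (0:ℝ) < (n:ℝ) := by positivity
      have harg : Complex.arg ((n:ℕ) : ℂ) ≠ π := by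
        rw [show ((n:ℕ) : ℂ) = ((n:ℝ) : ℂ) by push_cast; rfl,
          Complex.arg_ofReal_of_nonneg hn'.le]
        exact Real.pi_ne_zero.symm
      calc conj (((n:ℕ):ℂ) ^ (conj s)) = conj ((conj ((n:ℕ):ℂ)) ^ (conj s)) := by
            rw [Complex.conj_natCast]
        _ = ((n:ℕ):ℂ) ^ (conj (conj s)) := (Complex.cpow_conj _ _ harg).symm
        _ = ((n:ℕ):ℂ) ^ s := by rw [Complex.conj_conj]

/-- Conjugation symmetry of the completed `L`-function of a non-trivial character, on all of `ℂ`: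
`conj Λ(conj s, χ) = Λ(s, χ⁻¹)` (both sides entire; identity theorem from `re s > 1`, where
`Λ = gammaFactor · L` and `Γ_ℝ(conj s) = conj Γ_ℝ(s)`) (Davenport, Ch. 9). [folklore] -/
lemma completedLFunction_conj {χ : DirichletCharacter ℂ N} (hχ : χ ≠ 1) (s : ℂ) :
    conj (completedLFunction χ (conj s)) = completedLFunction χ⁻¹ s := by
  have hχ' : χ⁻¹ ≠ 1 := inv_ne_one.mpr hχ
  have hf : AnalyticOnNhd ℂ (completedLFunction χ⁻¹) Set.univ := fun z _ =>
    (differentiable_completedLFunction hχ').analyticAt z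
  have hgdiff : Differentiable ℂ (conj ∘ completedLFunction χ ∘ conj) := fun _ =>
    differentiableAt_conj_conj_iff.mpr (differentiable_completedLFunction hχ _)
  have hg : AnalyticOnNhd ℂ (conj ∘ completedLFunction χ ∘ conj) Set.univ := fun z _ =>
    hgdiff.analyticAt z
  have hagree : (conj ∘ completedLFunction χ ∘ conj)
      =ᶠ[nhds (2:ℂ)] completedLFunction χ⁻¹ := by
    have hmem : {z : ℂ | 1 < z.re} ∈ nhds (2:ℂ) :=
      (isOpen_lt continuous_const continuous_re).mem_nhds (by simp)
    filter_upwards [hmem] with z hz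
    have hre1 : 1 < z.re := hz
    have hΛ : ∀ (ψ : DirichletCharacter ℂ N) (w : ℂ), 0 < w.re →
        completedLFunction ψ w = gammaFactor ψ w * LFunction ψ w := by
      intro ψ w hw
      have hw0 : w ≠ 0 := fun h => by rw [h] at hw; simp at hw
      rw [LFunction_eq_completed_div_gammaFactor ψ w (Or.inl hw0)]
      field_simp [gammaFactor_ne_zero_of_re_pos ψ hw]
    show conj (completedLFunction χ (conj z)) = completedLFunction χ⁻¹ z
    rw [hΛ χ (conj z) (by rw [Complex.conj_re]; linarith),
      hΛ χ⁻¹ z (by linarith), map_mul, ← gammaFactor_conj, Complex.conj_conj,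
      LFunction_conj_of_one_lt_re χ hre1, gammaFactor_inv]
  have heq := hg.eqOn_of_preconnected_of_eventuallyEq hf isPreconnected_univ
    (Set.mem_univ (2:ℂ)) hagree
  have h1 := heq (Set.mem_univ s)
  simpa [Function.comp_apply] using h1

/-! ### Gauss sums of primitive characters: `|τ(χ)|² = N`, `‖W(χ)‖ = 1` -/

/-- `conj τ(χ, ψ) = τ(χ⁻¹, ψ⁻¹)` for complex-valued characters. [folklore] -/
lemma conj_gaussSum (χ : DirichletCharacter ℂ N) (ψ : AddChar (ZMod N) ℂ) :
    conj (gaussSum χ ψ) = gaussSum χ⁻¹ ψ⁻¹ := by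
  unfold gaussSum
  rw [map_sum]
  refine Finset.sum_congr rfl fun x _ => ?_
  rw [map_mul]
  congr 1
  · exact MulChar.star_apply' χ x
  · rw [AddChar.inv_apply', ← RCLike.inv_eq_conj (AddChar.norm_apply ψ x)]

/-- **`τ(χ) · conj τ(χ) = N`** for a PRIMITIVE character `χ` to any modulus `N`
(Davenport, *Multiplicative Number Theory*, Ch. 9, eq. (5) `|τ(χ)| = q^{1/2}`; Montgomery–Vaughan
Thm. 9.7). Proof: expand `conj τ = τ(χ⁻¹, ψ⁻¹)`, absorb `χ⁻¹(y)` into a shifted Gauss sum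
(`gaussSum_mulShift_of_isPrimitive`) and use orthogonality of additive characters
(`AddChar.sum_mulShift`). Mathlib's `gaussSum_mul_gaussSum_eq_card` covers fields only.
[cite: MontgomeryVaughan2007, Thm. 9.7] -/
theorem gaussSum_mul_conj_of_isPrimitive {χ : DirichletCharacter ℂ N} (hχ : IsPrimitive χ) :
    gaussSum χ (ZMod.stdAddChar (N := N)) * conj (gaussSum χ (ZMod.stdAddChar (N := N)))
      = (N : ℂ) := by
  classical
  set ψ : AddChar (ZMod N) ℂ := ZMod.stdAddChar (N := N) with hψdef
  rw [conj_gaussSum]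
  have expand2 : gaussSum χ⁻¹ ψ⁻¹ = ∑ y : ZMod N, χ⁻¹ y * ψ⁻¹ y := rfl
  rw [expand2, Finset.mul_sum]
  have step1 : ∀ y : ZMod N, gaussSum χ ψ * (χ⁻¹ y * ψ⁻¹ y)
      = ψ⁻¹ y * gaussSum χ (ψ.mulShift y) := by
    intro y
    rw [gaussSum_mulShift_of_isPrimitive ψ hχ y]
    ring
  rw [Finset.sum_congr rfl fun y _ => step1 y]
  have step2 : ∀ y : ZMod N, ψ⁻¹ y * gaussSum χ (ψ.mulShift y)
      = ∑ x : ZMod N, χ x * ψ (x * y - y) := by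
    intro y
    rw [gaussSum, Finset.mul_sum]
    refine Finset.sum_congr rfl fun x _ => ?_
    rw [AddChar.mulShift_apply, AddChar.inv_apply,
      show x * y - y = y * x + -y by ring, AddChar.map_add_eq_mul]
    ring
  rw [Finset.sum_congr rfl fun y _ => step2 y, Finset.sum_comm]
  have step3 : ∀ x : ZMod N, ∑ y : ZMod N, χ x * ψ (x * y - y)
      = χ x * (((if x - 1 = 0 then Fintype.card (ZMod N) else 0 : ℕ)) : ℂ) := by
    intro x
    rw [← Finset.mul_sum]
    congr 1
    rw [show (fun y => ψ (x * y - y)) = fun y => ψ (y * (x - 1)) by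
      funext y
      ring_nf]
    exact AddChar.sum_mulShift _ (ZMod.isPrimitive_stdAddChar N)
  rw [Finset.sum_congr rfl fun x _ => step3 x]
  have step4 : ∑ x : ZMod N, χ x * (((if x - 1 = 0 then Fintype.card (ZMod N) else 0 : ℕ)) : ℂ)
      = χ 1 * (Fintype.card (ZMod N) : ℂ) := by
    rw [Finset.sum_eq_single 1]
    · rw [if_pos (by ring)]
    · intro x _ hx
      rw [if_neg (fun h => hx (by linear_combination h)), Nat.cast_zero, mul_zero]
    · intro h
      exact absurd (Finset.mem_univ 1) h
  rw [step4, MulChar.map_one, one_mul, ZMod.card]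

/-- **`‖W(χ)‖ = 1`**: the root number `W(χ) = τ(χ)/(i^κ √N)` of a primitive character to any
modulus is unimodular (Davenport Ch. 9, from `|τ(χ)| = N^{1/2}`). [cite: MontgomeryVaughan2007, Thm. 9.7] -/
theorem norm_rootNumber {χ : DirichletCharacter ℂ N} (hχ : IsPrimitive χ) :
    ‖rootNumber χ‖ = 1 := by
  have hNpos : 0 < N := Nat.pos_of_ne_zero (NeZero.ne N)
  have hg2 : Complex.normSq (gaussSum χ (ZMod.stdAddChar (N := N))) = (N : ℝ) := by
    have h1 := congrArg Complex.re (Complex.mul_conj (gaussSum χ (ZMod.stdAddChar (N := N))))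
    rw [gaussSum_mul_conj_of_isPrimitive hχ] at h1
    simpa using h1.symm
  have hg : ‖gaussSum χ (ZMod.stdAddChar (N := N))‖ = Real.sqrt N := by
    rw [← Real.sqrt_sq (norm_nonneg _), ← Complex.normSq_eq_norm_sq, hg2]
  have hI : ∀ k : ℕ, ‖(I : ℂ) ^ k‖ = 1 := fun k => by
    rw [norm_pow, Complex.norm_I, one_pow]
  have hNhalf : ‖((N:ℕ) : ℂ) ^ (1/2 : ℂ)‖ = Real.sqrt N := by
    rw [norm_natCast_cpow_of_pos hNpos]
    rw [show (1/2 : ℂ).re = (1/2 : ℝ) by norm_num, Real.sqrt_eq_rpow]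
  have hs : Real.sqrt N ≠ 0 := by
    have : (0:ℝ) < N := by exact_mod_cast hNpos
    positivity
  rw [rootNumber, norm_div, norm_div, hI, hNhalf, hg]
  field_simp

/-! ### Elementary bounds: `sin`, the reciprocal Gamma function -/

/-- `‖sin z‖ ≤ exp ‖z‖` for complex `z`. [folklore] -/
lemma norm_sin_le_exp_norm (z : ℂ) : ‖Complex.sin z‖ ≤ Real.exp ‖z‖ := by
  have h2 : (2 : ℂ) * Complex.sin z = (cexp (-z * I) - cexp (z * I)) * I := Complex.two_sin z
  have h1 : ‖cexp (-z * I)‖ ≤ Real.exp ‖z‖ := by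
    refine (Complex.norm_exp_le_exp_norm _).trans ?_
    simp
  have h3 : ‖cexp (z * I)‖ ≤ Real.exp ‖z‖ := by
    refine (Complex.norm_exp_le_exp_norm _).trans ?_
    simp
  have h4 : ‖(2 : ℂ) * Complex.sin z‖ ≤ 2 * Real.exp ‖z‖ := by
    rw [h2, norm_mul, Complex.norm_I, mul_one]
    exact (norm_sub_le _ _).trans (by linarith)
  rw [norm_mul, Complex.norm_two] at h4
  linarith

/-- Reflection bound for the reciprocal Gamma function off the positive integers: if
`re z < 1` and `Γ(z) ≠ 0` then `‖Γ(z)‖⁻¹ = ‖Γ(1 - z)‖ · ‖sin (π z)‖ / π`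
(Euler's reflection formula `Γ(z)Γ(1-z) = π / sin(πz)`). [folklore] -/
lemma norm_Gamma_inv_eq {z : ℂ} (hz : z.re < 1) (hΓ : Complex.Gamma z ≠ 0) :
    ‖Complex.Gamma z‖⁻¹ = ‖Complex.Gamma (1 - z)‖ * ‖Complex.sin (π * z)‖ / π := by
  have hrefl := Complex.Gamma_mul_Gamma_one_sub z
  have hsin : Complex.sin (π * z) ≠ 0 := by
    intro h0
    rw [h0, div_zero, mul_eq_zero] at hrefl
    rcases hrefl with h | h
    · exact hΓ h
    · rw [Complex.Gamma_eq_zero_iff] at h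
      obtain ⟨m, hm⟩ := h
      have : (1 - z).re = -m := by rw [hm]; simp
      simp at this
      have hm0 : (0 : ℝ) ≤ m := m.cast_nonneg
      linarith
  have hπ : (π : ℂ) ≠ 0 := ofReal_ne_zero.mpr Real.pi_ne_zero
  have key : Complex.Gamma z * Complex.Gamma (1 - z) * Complex.sin (π * z) = π := by
    rw [hrefl, div_mul_cancel₀ _ hsin]
  have keyn : ‖Complex.Gamma z‖ * ‖Complex.Gamma (1 - z)‖ * ‖Complex.sin (π * z)‖ = π := by
    rw [← norm_mul, ← norm_mul, key, Complex.norm_real, Real.norm_eq_abs, abs_of_pos Real.pi_pos]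
  have ha : ‖Complex.Gamma z‖ ≠ 0 := norm_ne_zero_iff.mpr hΓ
  have key' : ‖Complex.Gamma (1 - z)‖ * ‖Complex.sin (π * z)‖ = π * ‖Complex.Gamma z‖⁻¹ := by
    rw [← div_eq_mul_inv, eq_div_iff ha]
    calc ‖Complex.Gamma (1 - z)‖ * ‖Complex.sin (π * z)‖ * ‖Complex.Gamma z‖
        = ‖Complex.Gamma z‖ * ‖Complex.Gamma (1 - z)‖ * ‖Complex.sin (π * z)‖ := by ring
      _ = π := keyn
  rw [key']
  field_simp

omit [NeZero N] in
/-- The gamma factor of `χ` is `Γ_ℝ(s + κ)` with `κ = 0` (`χ` even) or `κ = 1` (`χ` odd)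
(Montgomery–Vaughan §10.1). [folklore] -/
lemma gammaFactor_shape (χ : DirichletCharacter ℂ N) :
    ∃ κ : ℕ, κ ≤ 1 ∧ ∀ w, gammaFactor χ w = Gammaℝ (w + κ) := by
  rcases χ.even_or_odd with h | h
  · exact ⟨0, zero_le_one, fun w ↦ by rw [h.gammaFactor_def, Nat.cast_zero, add_zero]⟩
  · exact ⟨1, le_rfl, fun w ↦ by rw [h.gammaFactor_def, Nat.cast_one]⟩


/-! ### `L(s, χ)` is an entire function of finite order -/

/-- A crude bound for the real Gamma function: `Γ(y) ≤ 5 exp((1 + x)²)` for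
`1/4 ≤ y ≤ 1 + x` (from `Γ(y) ≤ 4 + exp(y log(1 + y))` and `log(1 + y) ≤ y`). [folklore] -/
lemma Real.Gamma_le_five_mul_exp {y x : ℝ} (hy : 1 / 4 ≤ y) (hyx : y ≤ 1 + x) (hx : 0 ≤ x) :
    Real.Gamma y ≤ 5 * Real.exp ((1 + x) ^ 2) := by
  have h1 := Literature.NumberTheory.LFunctions.Real.Gamma_le_of_quarter_le hy
  have hy0 : 0 < y := by linarith
  have hlog : Real.log (1 + y) ≤ y := by
    have := Real.log_le_sub_one_of_pos (show 0 < 1 + y by linarith)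
    linarith
  have h2 : y * Real.log (1 + y) ≤ (1 + x) ^ 2 := by
    calc y * Real.log (1 + y) ≤ y * y := by
          exact mul_le_mul_of_nonneg_left hlog hy0.le
      _ ≤ (1 + x) * (1 + x) := by
          exact mul_le_mul hyx hyx hy0.le (by linarith)
      _ = (1 + x) ^ 2 := by ring
  have h3 : Real.exp (y * Real.log (1 + y)) ≤ Real.exp ((1 + x) ^ 2) := Real.exp_le_exp.mpr h2
  have h4 : (1 : ℝ) ≤ Real.exp ((1 + x) ^ 2) := Real.one_le_exp (by positivity)
  linarith

/-- **Montgomery–Vaughan (4.22)-type bound on `re s ≥ 1/2`**: for a non-trivial character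
`χ` mod `N`, `‖L(s, χ)‖ ≤ N · Z · ‖s‖` with `Z = ∑_{n ≥ 1} n^{-3/2}` (partial summation,
`Literature.NumberTheory.LFunctions.DirichletAbel.norm_LFunction_le`). [folklore] -/
lemma norm_LFunction_le_of_half_le_re {χ : DirichletCharacter ℂ N} (hχ : χ ≠ 1) {s : ℂ}
    (hs : 1 / 2 ≤ s.re) :
    ‖LFunction χ s‖ ≤ N * (∑' n : ℕ, ((n + 1 : ℕ) : ℝ) ^ (-(1 / 2 : ℝ) - 1)) * ‖s‖ := by
  have hs0 : 0 < s.re := by linarith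
  have h := Literature.NumberTheory.LFunctions.DirichletAbel.norm_LFunction_le χ hχ hs0
  have hle : ∑' n : ℕ, ((n + 1 : ℕ) : ℝ) ^ (-s.re - 1) ≤
      ∑' n : ℕ, ((n + 1 : ℕ) : ℝ) ^ (-(1 / 2 : ℝ) - 1) := by
    refine Summable.tsum_le_tsum (fun n ↦ Real.rpow_le_rpow_of_exponent_le
      (by exact_mod_cast Nat.succ_le_succ (Nat.zero_le n)) (by linarith))
      (Literature.NumberTheory.LFunctions.DirichletAbel.summable_rpow_neg hs0) (Literature.NumberTheory.LFunctions.DirichletAbel.summable_rpow_neg (by norm_num))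
  calc ‖LFunction χ s‖ ≤ N * ‖s‖ * ∑' n : ℕ, ((n + 1 : ℕ) : ℝ) ^ (-s.re - 1) := h
    _ ≤ N * ‖s‖ * ∑' n : ℕ, ((n + 1 : ℕ) : ℝ) ^ (-(1 / 2 : ℝ) - 1) := by gcongr
    _ = _ := by ring

/-- The constant `Z = ∑_{n ≥ 1} n^{-3/2}` is non-negative. [folklore] -/
lemma tsum_rpow_nonneg : 0 ≤ ∑' n : ℕ, ((n + 1 : ℕ) : ℝ) ^ (-(1 / 2 : ℝ) - 1) :=
  tsum_nonneg fun _ ↦ Real.rpow_nonneg (Nat.cast_nonneg _) _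

/-- **The bound on `re s < 1/2` via the functional equation** (Davenport Ch. 9–10 /
Montgomery–Vaughan §10.1: `L(s, χ) = ε(χ) N^{1/2-s} (γ(1-s)/γ(s)) L(1-s, χ̄)` with
`1/Γ(z) = Γ(1-z) sin(πz)/π`): for a primitive `χ` mod `N ≠ 1` whose gamma factor is
`Γ_ℝ(s + κ)` (`κ ∈ {0, 1}`),
`‖L(s, χ)‖ ≤ 25 N Z · N^{1/2 + ‖s‖} (1 + ‖s‖) exp(2(1 + ‖s‖)² + π(1 + ‖s‖))`. [folklore] -/
lemma norm_LFunction_le_of_re_lt_half {χ : DirichletCharacter ℂ N} (hprim : IsPrimitive χ)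
    (hN : N ≠ 1) (κ : ℕ) (hκ : κ ≤ 1) (hgf : ∀ w, gammaFactor χ w = Gammaℝ (w + κ)) {s : ℂ}
    (hs : s.re < 1 / 2) :
    ‖LFunction χ s‖ ≤ 25 * N * (∑' n : ℕ, ((n + 1 : ℕ) : ℝ) ^ (-(1 / 2 : ℝ) - 1)) *
      (N : ℝ) ^ (1 / 2 + ‖s‖) * (1 + ‖s‖) *
        Real.exp (2 * (1 + ‖s‖) ^ 2 + π * (1 + ‖s‖)) := by
  set Z : ℝ := ∑' n : ℕ, ((n + 1 : ℕ) : ℝ) ^ (-(1 / 2 : ℝ) - 1) with hZ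
  set x : ℝ := ‖s‖ with hx
  have hx0 : 0 ≤ x := norm_nonneg _
  have hZ0 : 0 ≤ Z := tsum_rpow_nonneg
  have hNpos : 0 < N := Nat.pos_of_ne_zero (NeZero.ne N)
  have hN1 : (1 : ℝ) ≤ N := by exact_mod_cast hNpos
  have hκR : (κ : ℝ) ≤ 1 := by exact_mod_cast hκ
  have hκ0 : (0 : ℝ) ≤ κ := Nat.cast_nonneg κ
  have hσx : |s.re| ≤ x := abs_re_le_norm s
  have hσ1 : -x ≤ s.re := (abs_le.mp hσx).1
  have hσ2 : s.re ≤ x := (abs_le.mp hσx).2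
  have hχ1 : χ ≠ 1 := ne_one_of_isPrimitive hN hprim
  set w : ℂ := 1 - s with hw
  have hwre : w.re = 1 - s.re := by simp [hw]
  have hw2 : 1 / 2 ≤ w.re := by rw [hwre]; linarith
  have hw0 : 0 < w.re := by linarith
  -- the representation through the functional equation
  have hL : LFunction χ s = completedLFunction χ s / gammaFactor χ s :=
    LFunction_eq_completed_div_gammaFactor χ s (Or.inr hN)
  have hFE : completedLFunction χ s = N ^ (w - 1 / 2) * rootNumber χ * completedLFunction χ⁻¹ w := by
    have := hprim.completedLFunction_one_sub w
    rwa [show 1 - w = s by simp [hw]] at this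
  have hΛw : completedLFunction χ⁻¹ w = gammaFactor χ w * LFunction χ⁻¹ w := by
    have hw0' : w ≠ 0 := fun h ↦ by rw [h] at hw0; simp at hw0
    rw [LFunction_eq_completed_div_gammaFactor χ⁻¹ w (Or.inr hN), gammaFactor_inv]
    field_simp [gammaFactor_ne_zero_of_re_pos χ hw0]
  set z : ℂ := (s + κ) / 2 with hzdef
  have hzre : z.re = (s.re + κ) / 2 := by simp [hzdef]
  have hπ0 : (π : ℂ) ≠ 0 := ofReal_ne_zero.mpr Real.pi_ne_zero
  have hrepr : LFunction χ s = (N : ℂ) ^ (w - 1 / 2) * rootNumber χ *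
      ((π : ℂ) ^ (-(w + κ) / 2) * Complex.Gamma ((w + κ) / 2)) * LFunction χ⁻¹ w *
        (π : ℂ) ^ ((s + κ) / 2) * (Complex.Gamma z)⁻¹ := by
    rw [hL, hFE, hΛw, hgf, hgf, Gammaℝ_def, Gammaℝ_def, div_eq_mul_inv, mul_inv,
      show (-(s + ↑κ) / 2) = -((s + κ) / 2) by ring, cpow_neg, inv_inv]
    ring
  -- the seven factors
  have f1 : ‖(N : ℂ) ^ (w - 1 / 2)‖ ≤ (N : ℝ) ^ (1 / 2 + x) := by
    rw [norm_natCast_cpow_of_pos hNpos]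
    refine Real.rpow_le_rpow_of_exponent_le hN1 ?_
    simp only [sub_re, hwre, one_div]
    norm_num
    linarith
  have f2 : ‖rootNumber χ‖ ≤ 1 := (norm_rootNumber hprim).le
  have f3 : ‖(π : ℂ) ^ (-(w + κ) / 2)‖ ≤ 1 := by
    rw [Complex.norm_cpow_eq_rpow_re_of_pos Real.pi_pos]
    refine Real.rpow_le_one_of_one_le_of_nonpos (by linarith [Real.two_le_pi]) ?_
    have : (-(w + (κ : ℂ)) / 2).re = -(w.re + κ) / 2 := by simp
    rw [this, hwre]
    linarith
  have f4 : ‖Complex.Gamma ((w + κ) / 2)‖ ≤ 5 * Real.exp ((1 + x) ^ 2) := by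
    have hre : ((w + (κ : ℂ)) / 2).re = (1 - s.re + κ) / 2 := by simp [hwre]
    refine (Literature.NumberTheory.LFunctions.norm_Gamma_le_Gamma_re (by rw [hre]; linarith)).trans ?_
    rw [hre]
    exact Real.Gamma_le_five_mul_exp (by linarith) (by linarith) hx0
  have f5 : ‖LFunction χ⁻¹ w‖ ≤ N * Z * (1 + x) := by
    refine (norm_LFunction_le_of_half_le_re (inv_ne_one.mpr hχ1) hw2).trans ?_
    have : ‖w‖ ≤ 1 + x := by
      calc ‖w‖ = ‖(1 : ℂ) - s‖ := rfl
        _ ≤ ‖(1 : ℂ)‖ + ‖s‖ := norm_sub_le _ _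
        _ = 1 + x := by simp [hx]
    have h0 : (0 : ℝ) ≤ N * Z := by positivity
    exact mul_le_mul_of_nonneg_left this h0
  have f6 : ‖(π : ℂ) ^ ((s + κ) / 2)‖ ≤ π := by
    rw [Complex.norm_cpow_eq_rpow_re_of_pos Real.pi_pos]
    have hπ1 : (1 : ℝ) ≤ π := by linarith [Real.two_le_pi]
    calc π ^ ((s + (κ : ℂ)) / 2).re ≤ π ^ (1 : ℝ) := by
          refine Real.rpow_le_rpow_of_exponent_le hπ1 ?_
          have : ((s + (κ : ℂ)) / 2).re = (s.re + κ) / 2 := by simp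
          rw [this]
          linarith
      _ = π := Real.rpow_one π
  -- case split on the trivial zeros
  by_cases hΓz : Complex.Gamma z = 0
  · rw [hrepr, hΓz, inv_zero, mul_zero, norm_zero]
    positivity
  have hz1 : z.re < 1 := by rw [hzre]; linarith
  have f7 : ‖Complex.Gamma z‖⁻¹ ≤ 5 * Real.exp ((1 + x) ^ 2) * Real.exp (π * (1 + x)) / π := by
    rw [norm_Gamma_inv_eq hz1 hΓz]
    have hA : ‖Complex.Gamma (1 - z)‖ ≤ 5 * Real.exp ((1 + x) ^ 2) := by
      have hre : (1 - z).re = 1 - (s.re + κ) / 2 := by rw [sub_re, one_re, hzre]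
      refine (Literature.NumberTheory.LFunctions.norm_Gamma_le_Gamma_re (by rw [hre]; linarith)).trans ?_
      rw [hre]
      exact Real.Gamma_le_five_mul_exp (by linarith) (by linarith) hx0
    have hB : ‖Complex.sin (π * z)‖ ≤ Real.exp (π * (1 + x)) := by
      refine (norm_sin_le_exp_norm _).trans (Real.exp_le_exp.mpr ?_)
      rw [norm_mul, Complex.norm_real, Real.norm_eq_abs, abs_of_pos Real.pi_pos]
      refine mul_le_mul_of_nonneg_left ?_ Real.pi_pos.le
      calc ‖z‖ = ‖s + κ‖ / 2 := by simp [hzdef]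
        _ ≤ (‖s‖ + ‖(κ : ℂ)‖) / 2 := by gcongr; exact norm_add_le _ _
        _ ≤ 1 + x := by
            rw [Complex.norm_natCast]
            linarith
    have hπpos := Real.pi_pos
    gcongr
  -- assemble
  have hprod : ‖LFunction χ s‖ = ‖(N : ℂ) ^ (w - 1 / 2)‖ * ‖rootNumber χ‖ *
      (‖(π : ℂ) ^ (-(w + κ) / 2)‖ * ‖Complex.Gamma ((w + κ) / 2)‖) * ‖LFunction χ⁻¹ w‖ *
        ‖(π : ℂ) ^ ((s + κ) / 2)‖ * ‖Complex.Gamma z‖⁻¹ := by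
    rw [hrepr]
    simp only [norm_mul, norm_inv]
  rw [hprod]
  have hexp0 : 0 ≤ Real.exp ((1 + x) ^ 2) := (Real.exp_pos _).le
  calc ‖(N : ℂ) ^ (w - 1 / 2)‖ * ‖rootNumber χ‖ *
      (‖(π : ℂ) ^ (-(w + κ) / 2)‖ * ‖Complex.Gamma ((w + κ) / 2)‖) * ‖LFunction χ⁻¹ w‖ *
        ‖(π : ℂ) ^ ((s + κ) / 2)‖ * ‖Complex.Gamma z‖⁻¹
      ≤ (N : ℝ) ^ (1 / 2 + x) * 1 * (1 * (5 * Real.exp ((1 + x) ^ 2))) * (N * Z * (1 + x)) *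
        π * (5 * Real.exp ((1 + x) ^ 2) * Real.exp (π * (1 + x)) / π) := by
          gcongr
    _ = 25 * N * Z * (N : ℝ) ^ (1 / 2 + x) * (1 + x) *
        Real.exp (2 * (1 + x) ^ 2 + π * (1 + x)) := by
          have : Real.exp (2 * (1 + x) ^ 2 + π * (1 + x)) =
              Real.exp ((1 + x) ^ 2) * Real.exp ((1 + x) ^ 2) * Real.exp (π * (1 + x)) := by
            rw [← Real.exp_add, ← Real.exp_add]; ring_nf
          rw [this]
          field_simp
          ring

/-- **`L(s, χ)` is of finite order**, explicit crude form: for a primitive `χ` mod `N ≠ 1`,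
`‖L(s, χ)‖ ≤ 25 N Z · exp((N + 7)(1 + ‖s‖)²)` for all `s`, `Z = ∑ n^{-3/2}`
(Davenport, *Multiplicative Number Theory*, Ch. 12 ("integral functions of order 1");
here via partial summation on `re s ≥ 1/2` and the functional equation on `re s < 1/2`).
[folklore] -/
theorem norm_LFunction_le_exp {χ : DirichletCharacter ℂ N} (hprim : IsPrimitive χ) (hN : N ≠ 1)
    (s : ℂ) :
    ‖LFunction χ s‖ ≤ 25 * N * (∑' n : ℕ, ((n + 1 : ℕ) : ℝ) ^ (-(1 / 2 : ℝ) - 1)) *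
      Real.exp ((N + 7) * (1 + ‖s‖) ^ 2) := by
  set Z : ℝ := ∑' n : ℕ, ((n + 1 : ℕ) : ℝ) ^ (-(1 / 2 : ℝ) - 1) with hZ
  set x : ℝ := ‖s‖ with hx
  have hx0 : 0 ≤ x := norm_nonneg _
  have hZ0 : 0 ≤ Z := tsum_rpow_nonneg
  have hNpos : 0 < N := Nat.pos_of_ne_zero (NeZero.ne N)
  have hN1 : (1 : ℝ) ≤ N := by exact_mod_cast hNpos
  have hN0 : (0 : ℝ) ≤ N := by positivity
  have hχ1 : χ ≠ 1 := ne_one_of_isPrimitive hN hprim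
  have h1x : 1 + x ≤ (1 + x) ^ 2 := by nlinarith
  have hE1 : 1 ≤ Real.exp ((N + 7) * (1 + x) ^ 2) := Real.one_le_exp (by positivity)
  rcases le_or_gt (1 / 2 : ℝ) s.re with hs | hs
  · have h := norm_LFunction_le_of_half_le_re hχ1 hs
    have hx1 : x ≤ Real.exp ((N + 7) * (1 + x) ^ 2) := by
      calc x ≤ x + 1 := by linarith
        _ ≤ Real.exp x := Real.add_one_le_exp x
        _ ≤ Real.exp ((N + 7) * (1 + x) ^ 2) := Real.exp_le_exp.mpr (by nlinarith)
    calc ‖LFunction χ s‖ ≤ N * Z * x := h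
      _ ≤ N * Z * Real.exp ((N + 7) * (1 + x) ^ 2) := by gcongr
      _ ≤ 25 * N * Z * Real.exp ((N + 7) * (1 + x) ^ 2) := by
          have h0 : 0 ≤ N * Z * Real.exp ((N + 7) * (1 + x) ^ 2) := by positivity
          linarith
  · -- gamma factor shape by parity
    obtain ⟨κ, hκ, hgf⟩ : ∃ κ : ℕ, κ ≤ 1 ∧ ∀ w, gammaFactor χ w = Gammaℝ (w + κ) := by
      rcases χ.even_or_odd with h | h
      · exact ⟨0, zero_le_one, fun w ↦ by rw [h.gammaFactor_def, Nat.cast_zero, add_zero]⟩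
      · exact ⟨1, le_rfl, fun w ↦ by rw [h.gammaFactor_def, Nat.cast_one]⟩
    have h := norm_LFunction_le_of_re_lt_half hprim hN κ hκ hgf hs
    -- `N^{1/2+x} (1+x) exp(2(1+x)² + π(1+x)) ≤ exp((N+7)(1+x)²)`
    have hA : (N : ℝ) ^ (1 / 2 + x) ≤ Real.exp (N * (1 + x)) := by
      rw [Real.rpow_def_of_pos (by positivity)]
      refine Real.exp_le_exp.mpr ?_
      have hlog : Real.log N ≤ N := (Real.log_le_sub_one_of_pos (by positivity)).trans (by linarith)
      have hlog0 : 0 ≤ Real.log N := Real.log_nonneg hN1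
      nlinarith
    have hB : 1 + x ≤ Real.exp (1 + x) := by linarith [Real.add_one_le_exp (1 + x)]
    have hC : Real.exp (N * (1 + x)) * Real.exp (1 + x) *
        Real.exp (2 * (1 + x) ^ 2 + π * (1 + x)) ≤ Real.exp ((N + 7) * (1 + x) ^ 2) := by
      rw [← Real.exp_add, ← Real.exp_add]
      refine Real.exp_le_exp.mpr ?_
      have hπ4 : π ≤ 4 := Real.pi_le_four
      nlinarith
    calc ‖LFunction χ s‖ ≤ 25 * N * Z * (N : ℝ) ^ (1 / 2 + x) * (1 + x) *
        Real.exp (2 * (1 + x) ^ 2 + π * (1 + x)) := h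
      _ ≤ 25 * N * Z * Real.exp (N * (1 + x)) * Real.exp (1 + x) *
        Real.exp (2 * (1 + x) ^ 2 + π * (1 + x)) := by gcongr
      _ = 25 * N * Z * (Real.exp (N * (1 + x)) * Real.exp (1 + x) *
        Real.exp (2 * (1 + x) ^ 2 + π * (1 + x))) := by ring
      _ ≤ 25 * N * Z * Real.exp ((N + 7) * (1 + x) ^ 2) := by gcongr

/-- From a Gaussian-type bound to the Selberg-class shape `A exp(‖s‖^B)`: for `c ≥ 0`,
`c (1 + x)² ≤ 2c + 8c³ + x³` for all `x ≥ 0`. [folklore] -/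
lemma mul_one_add_sq_le {c x : ℝ} (hc : 0 ≤ c) (hx : 0 ≤ x) :
    c * (1 + x) ^ 2 ≤ 2 * c + 8 * c ^ 3 + x ^ 3 := by
  have h1 : c * (1 + x) ^ 2 ≤ 2 * c + 2 * c * x ^ 2 := by nlinarith [sq_nonneg (1 - x)]
  have h2 : 2 * c * x ^ 2 ≤ 8 * c ^ 3 + x ^ 3 := by
    rcases le_or_gt x (2 * c) with h | h
    · nlinarith [mul_le_mul_of_nonneg_left (mul_self_le_mul_self hx h) (by linarith : 0 ≤ 2 * c),
        pow_nonneg hx 3]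
    · nlinarith [mul_le_mul_of_nonneg_right h.le (sq_nonneg x), pow_nonneg hc 3]
  linarith

/-- **`L(s, χ)` is an entire function of finite order** (Davenport Ch. 12; Selberg's axiom (ii)
for `L(s, χ)`, Kaczorowski–Perelli survey §1): for a primitive `χ` mod `N ≠ 1` there are `A, B`
with `‖L(s, χ)‖ ≤ A exp(‖s‖^B)` for all `s` (we get `B = 3`). [folklore] -/
theorem exists_norm_LFunction_le_exp_rpow {χ : DirichletCharacter ℂ N} (hprim : IsPrimitive χ)
    (hN : N ≠ 1) :
    ∃ A B : ℝ, ∀ s : ℂ, ‖LFunction χ s‖ ≤ A * Real.exp (‖s‖ ^ B) := by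
  set Z : ℝ := ∑' n : ℕ, ((n + 1 : ℕ) : ℝ) ^ (-(1 / 2 : ℝ) - 1) with hZ
  have hZ0 : 0 ≤ Z := tsum_rpow_nonneg
  refine ⟨25 * N * Z * Real.exp (2 * (N + 7) + 8 * (N + 7) ^ 3), 3, fun s ↦ ?_⟩
  have h := norm_LFunction_le_exp hprim hN s
  have hN0 : (0 : ℝ) ≤ N := Nat.cast_nonneg N
  have hkey := mul_one_add_sq_le (c := (N : ℝ) + 7) (by positivity) (norm_nonneg s)
  have h3 : ‖s‖ ^ (3 : ℝ) = ‖s‖ ^ (3 : ℕ) := by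
    rw [show (3 : ℝ) = ((3 : ℕ) : ℝ) by norm_num, Real.rpow_natCast]
  calc ‖LFunction χ s‖ ≤ 25 * N * Z * Real.exp ((N + 7) * (1 + ‖s‖) ^ 2) := h
    _ ≤ 25 * N * Z * Real.exp (2 * (N + 7) + 8 * (N + 7) ^ 3 + ‖s‖ ^ (3 : ℕ)) := by
        gcongr
    _ = 25 * N * Z * Real.exp (2 * (N + 7) + 8 * (N + 7) ^ 3) * Real.exp (‖s‖ ^ (3 : ℝ)) := by
        rw [h3, Real.exp_add]; ring

/-! ### The Euler product: `log L(s, χ)` as a Dirichlet series over prime powers -/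

omit [NeZero N] in
/-- The coefficient `Λ(n)/log n` (`= 1/k` at `n = p^k`, `0` off prime powers) has absolute value
at most `1`. [folklore] -/
lemma norm_vonMangoldt_div_log_le (n : ℕ) :
    ‖((ArithmeticFunction.vonMangoldt n / Real.log n : ℝ) : ℂ)‖ ≤ 1 := by
  rw [Complex.norm_real, Real.norm_eq_abs]
  rcases eq_or_ne (Real.log n) 0 with h0 | h0
  · rw [h0, div_zero, abs_zero]; exact zero_le_one
  · rw [abs_div, div_le_one (abs_pos.mpr h0), abs_of_nonneg ArithmeticFunction.vonMangoldt_nonneg,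
      abs_of_nonneg (Real.log_natCast_nonneg n)]
    exact ArithmeticFunction.vonMangoldt_le_log

omit [NeZero N] in
/-- `Λ(p^{k+1}) / log(p^{k+1}) = 1/(k+1)`. [folklore] -/
lemma vonMangoldt_div_log_prime_pow (p : Nat.Primes) (k : ℕ) :
    ((ArithmeticFunction.vonMangoldt ((p : ℕ) ^ (k + 1)) /
        Real.log (((p : ℕ) ^ (k + 1) : ℕ) : ℝ) : ℝ) : ℂ) = 1 / (k + 1 : ℂ) := by
  have hp : (p : ℕ).Prime := p.prop
  have hlogp : Real.log p ≠ 0 := by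
    have : (1 : ℝ) < p := by exact_mod_cast hp.one_lt
    exact (Real.log_pos this).ne'
  rw [ArithmeticFunction.vonMangoldt_apply_pow (Nat.succ_ne_zero k),
    ArithmeticFunction.vonMangoldt_apply_prime hp, Nat.cast_pow, Real.log_pow]
  have h : Real.log p / (((k + 1 : ℕ) : ℝ) * Real.log p) = 1 / ((k : ℝ) + 1) := by
    rw [Nat.cast_succ]
    field_simp
  rw [h]
  push_cast
  rfl

/-- **The Euler product in Selberg's form (axiom (v)) for `L(s, χ)`**: with
`b(n) = χ(n) Λ(n)/log n` (so `b(p^k) = χ(p)^k/k` and `b = 0` off prime powers),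
`exp(∑ b(n) n^{-s}) = L(s, χ)` for `re s > 1` (Davenport, *Multiplicative Number Theory*, Ch. 5;
Kaczorowski–Perelli survey §1, Example 2). From Mathlib's
`DirichletCharacter.LSeries_eulerProduct_exp_log` (`exp ∑_p -log(1 - χ(p)p^{-s}) = L(s, χ)`) and
the logarithmic series `-log(1 - z) = ∑_{k ≥ 1} z^k/k`, reindexing prime powers by
`Nat.Primes.prodNatEquiv`. [folklore] -/
theorem exp_LSeries_vonMangoldt_div_log_eq (χ : DirichletCharacter ℂ N) {s : ℂ} (hs : 1 < s.re) :
    cexp (LSeries (fun n ↦ χ n *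
      ((ArithmeticFunction.vonMangoldt n / Real.log n : ℝ) : ℂ)) s) = LFunction χ s := by
  classical
  set c : ℕ → ℂ := fun n ↦ ((ArithmeticFunction.vonMangoldt n / Real.log n : ℝ) : ℂ) with hc
  set f := dirichletSummandHom χ (ne_zero_of_one_lt_re hs) with hf
  have hfapply : ∀ n : ℕ, f n = χ n * (n : ℂ) ^ (-s) := fun n ↦ rfl
  -- the terms of the series are `c n * f n`
  have hterm : ∀ n, LSeries.term (fun n ↦ χ n *
      ((ArithmeticFunction.vonMangoldt n / Real.log n : ℝ) : ℂ)) s n = c n * f n := by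
    intro n
    rcases eq_or_ne n 0 with rfl | hn
    · simp [LSeries.term_zero, hfapply, ne_zero_of_one_lt_re hs]
    · rw [LSeries.term_of_ne_zero hn, hfapply, cpow_neg, div_eq_mul_inv]; ring
  have hc_zero : ∀ n, ¬ IsPrimePow n → c n = 0 := by
    intro n hn
    simp [hc, ArithmeticFunction.vonMangoldt_eq_zero_iff.mpr hn]
  -- summability
  have hsumf : Summable (fun n ↦ ‖f n‖) := summable_dirichletSummand χ hs
  have hsumF : Summable (fun n ↦ c n * f n) := by
    refine Summable.of_norm_bounded hsumf (fun n ↦ ?_)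
    rw [norm_mul]
    exact mul_le_of_le_one_left (norm_nonneg _) (norm_vonMangoldt_div_log_le n)
  -- reindexing prime powers by `(p, k) ↦ p^(k+1)`
  have hg_inj : Function.Injective (fun pk : Nat.Primes × ℕ ↦ (pk.1 : ℕ) ^ (pk.2 + 1)) := by
    intro a b hab
    have h' : (Nat.Primes.prodNatEquiv a : ℕ) = Nat.Primes.prodNatEquiv b := hab
    exact Nat.Primes.prodNatEquiv.injective (Subtype.ext h')
  have hrange : Function.support (fun n ↦ c n * f n) ⊆
      Set.range (fun pk : Nat.Primes × ℕ ↦ (pk.1 : ℕ) ^ (pk.2 + 1)) := by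
    intro n hn
    have hpp : IsPrimePow n := by
      by_contra h
      exact hn (by simp [hc_zero n h])
    refine ⟨Nat.Primes.prodNatEquiv.symm ⟨n, hpp⟩, ?_⟩
    change ((Nat.Primes.prodNatEquiv (Nat.Primes.prodNatEquiv.symm ⟨n, hpp⟩)) : ℕ) = n
    rw [Equiv.apply_symm_apply]
  have hsumG : Summable (fun pk : Nat.Primes × ℕ ↦
      c ((pk.1 : ℕ) ^ (pk.2 + 1)) * f ((pk.1 : ℕ) ^ (pk.2 + 1))) :=
    hsumF.comp_injective hg_inj
  -- the inner sums are logarithmic series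
  have hinner : ∀ p : Nat.Primes,
      ∑' k : ℕ, c ((p : ℕ) ^ (k + 1)) * f ((p : ℕ) ^ (k + 1)) = -log (1 - f p) := by
    intro p
    have hp1 : 1 < (p : ℕ) := p.prop.one_lt
    have hfp : ‖f p‖ < 1 := hsumf.of_norm.norm_lt_one (f := f.toMonoidHom) hp1
    have hlog := (hasSum_nat_add_iff' 1).mpr (Complex.hasSum_taylorSeries_neg_log hfp)
    simp only [Finset.range_one, Finset.sum_singleton, pow_zero, Nat.cast_zero, div_zero,
      sub_zero] at hlog
    rw [← hlog.tsum_eq]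
    refine tsum_congr fun k ↦ ?_
    rw [show c ((p : ℕ) ^ (k + 1)) = 1 / (k + 1 : ℂ) from vonMangoldt_div_log_prime_pow p k,
      map_pow]
    push_cast
    ring
  rw [LFunction_eq_LSeries χ hs, ← DirichletCharacter.LSeries_eulerProduct_exp_log χ hs]
  congr 1
  rw [LSeries, tsum_congr hterm]
  calc ∑' n, c n * f n
      = ∑' pk : Nat.Primes × ℕ, c ((pk.1 : ℕ) ^ (pk.2 + 1)) * f ((pk.1 : ℕ) ^ (pk.2 + 1)) :=
        (hg_inj.tsum_eq hrange).symm
    _ = ∑' (p : Nat.Primes) (k : ℕ), c ((p : ℕ) ^ (k + 1)) * f ((p : ℕ) ^ (k + 1)) :=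
        Summable.tsum_prod hsumG
    _ = ∑' p : Nat.Primes, -log (1 - f p) := tsum_congr hinner
    _ = _ := tsum_congr fun p ↦ by rw [hfapply]

/-! ### The functional equation in Selberg's normalisation -/

/-- `conj (x^e) = x^(conj e)` for real `x ≥ 0`. [folklore] -/
lemma conj_ofReal_cpow {x : ℝ} (hx : 0 ≤ x) (e : ℂ) : conj ((x : ℂ) ^ e) = (x : ℂ) ^ (conj e) := by
  rw [Complex.cpow_conj _ _ ?_, Complex.conj_ofReal]
  rw [Complex.arg_ofReal_of_nonneg hx]
  exact Real.pi_ne_zero.symm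

/-- `Q^w = N^{w/2} π^{-w/2}` for Selberg's `Q = (N/π)^{1/2}`. [folklore] -/
lemma sqrt_cpow_eq (w : ℂ) :
    ((Real.sqrt (N / π) : ℝ) : ℂ) ^ w = (N : ℂ) ^ (w / 2) * (π : ℂ) ^ (-w / 2) := by
  have hN : (0 : ℝ) < N := by exact_mod_cast Nat.pos_of_ne_zero (NeZero.ne N)
  have hNπ : 0 < (N : ℝ) / π := div_pos hN Real.pi_pos
  have hQ : 0 < Real.sqrt (N / π) := Real.sqrt_pos.mpr hNπ
  rw [Complex.cpow_def_of_ne_zero (ofReal_ne_zero.mpr hQ.ne'),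
    Complex.cpow_def_of_ne_zero (Nat.cast_ne_zero.mpr (NeZero.ne N)),
    Complex.cpow_def_of_ne_zero (ofReal_ne_zero.mpr Real.pi_ne_zero), ← Complex.exp_add]
  congr 1
  rw [← Complex.ofReal_log hQ.le, Real.log_sqrt hNπ.le, Real.log_div hN.ne' Real.pi_ne_zero,
    ← Complex.ofReal_natCast, ← Complex.ofReal_log hN.le, ← Complex.ofReal_log Real.pi_pos.le]
  push_cast
  ring

/-- Selberg's completed function of `L(s, χ)` in terms of Mathlib's: for `re w > 0` and `N ≠ 1`,
`Q^w Γ(w/2 + κ/2) L(w, χ) = π^{κ/2} N^{w/2} Λ(w, χ)` (`Q = (N/π)^{1/2}`,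
`Λ = Γ_ℝ(· + κ) · L`; Kaczorowski–Perelli survey §1, Example 2). [folklore] -/
lemma selbergPhi_eq {χ : DirichletCharacter ℂ N} (hN : N ≠ 1) (κ : ℕ)
    (hgf : ∀ w, gammaFactor χ w = Gammaℝ (w + κ)) {w : ℂ} (hw : 0 < w.re) :
    ((Real.sqrt (N / π) : ℝ) : ℂ) ^ w * Complex.Gamma ((1 / 2 : ℝ) * w + (κ : ℂ) / 2) *
      LFunction χ w = (π : ℂ) ^ ((κ : ℂ) / 2) * (N : ℂ) ^ (w / 2) * completedLFunction χ w := by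
  have hL : LFunction χ w = completedLFunction χ w / gammaFactor χ w :=
    LFunction_eq_completed_div_gammaFactor χ w (Or.inr hN)
  have hΓ : Complex.Gamma ((w + κ) / 2) ≠ 0 := by
    refine Complex.Gamma_ne_zero_of_re_pos ?_
    have : ((w + (κ : ℂ)) / 2).re = (w.re + κ) / 2 := by simp
    rw [this]
    positivity
  have hπ0 : (π : ℂ) ≠ 0 := ofReal_ne_zero.mpr Real.pi_ne_zero
  have harg : ((1 / 2 : ℝ) : ℂ) * w + (κ : ℂ) / 2 = (w + κ) / 2 := by push_cast; ring
  have e1 : (π : ℂ) ^ (-w / 2) * ((π : ℂ) ^ (-(w + κ) / 2))⁻¹ = (π : ℂ) ^ ((κ : ℂ) / 2) := by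
    rw [← cpow_neg, ← cpow_add _ _ hπ0]
    congr 1
    ring
  rw [hL, hgf, Gammaℝ_def, sqrt_cpow_eq, harg]
  calc (N : ℂ) ^ (w / 2) * (π : ℂ) ^ (-w / 2) * Complex.Gamma ((w + κ) / 2) *
      (completedLFunction χ w / ((π : ℂ) ^ (-(w + κ) / 2) * Complex.Gamma ((w + κ) / 2)))
      = (N : ℂ) ^ (w / 2) * completedLFunction χ w *
          ((π : ℂ) ^ (-w / 2) * ((π : ℂ) ^ (-(w + κ) / 2))⁻¹) *
          (Complex.Gamma ((w + κ) / 2) * (Complex.Gamma ((w + κ) / 2))⁻¹) := by ring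
    _ = (N : ℂ) ^ (w / 2) * completedLFunction χ w * (π : ℂ) ^ ((κ : ℂ) / 2) := by
        rw [mul_inv_cancel₀ hΓ, mul_one, e1]
    _ = _ := by ring

/-- **The functional equation of `L(s, χ)` in Selberg's form** (axiom (iii) with `Q = (N/π)^{1/2}`,
one gamma factor `Γ(s/2 + κ/2)`, `ω = W(χ)` Mathlib's root number): on the critical strip,
`Φ(s) = W(χ) · conj Φ(1 - conj s)`. From Mathlib's `completedLFunction_one_sub`
(`Λ(1 - s, χ) = N^{s-1/2} W(χ) Λ(s, χ̄)`) and the conjugation symmetry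
`conj Λ(conj s, χ) = Λ(s, χ̄)` (Kaczorowski–Perelli survey §1, Example 2; Davenport Ch. 9).
[folklore] -/
theorem functional_equation_selberg {χ : DirichletCharacter ℂ N} (hprim : IsPrimitive χ)
    (hN : N ≠ 1) (κ : ℕ) (hgf : ∀ w, gammaFactor χ w = Gammaℝ (w + κ)) {s : ℂ}
    (hs0 : 0 < s.re) (hs1 : s.re < 1) :
    ((Real.sqrt (N / π) : ℝ) : ℂ) ^ s * Complex.Gamma ((1 / 2 : ℝ) * s + (κ : ℂ) / 2) *
        LFunction χ s =
      rootNumber χ * conj (((Real.sqrt (N / π) : ℝ) : ℂ) ^ (1 - conj s) *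
        Complex.Gamma ((1 / 2 : ℝ) * (1 - conj s) + (κ : ℂ) / 2) * LFunction χ (1 - conj s)) := by
  have hχ1 : χ ≠ 1 := ne_one_of_isPrimitive hN hprim
  have hN0 : (N : ℂ) ≠ 0 := Nat.cast_ne_zero.mpr (NeZero.ne N)
  have hw : 0 < (1 - conj s).re := by simp; linarith
  rw [selbergPhi_eq hN κ hgf hs0, selbergPhi_eq hN κ hgf hw, map_mul, map_mul]
  -- the three conjugates
  have h1 : conj ((π : ℂ) ^ ((κ : ℂ) / 2)) = (π : ℂ) ^ ((κ : ℂ) / 2) := by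
    rw [conj_ofReal_cpow Real.pi_pos.le, map_div₀, map_natCast, map_ofNat]
  have h2 : conj ((N : ℂ) ^ ((1 - conj s) / 2)) = (N : ℂ) ^ ((1 - s) / 2) := by
    rw [← Complex.ofReal_natCast, conj_ofReal_cpow (Nat.cast_nonneg N), map_div₀, map_sub, map_one,
      Complex.conj_conj, map_ofNat]
  have h3 : conj (completedLFunction χ (1 - conj s)) = completedLFunction χ⁻¹ (1 - s) := by
    rw [show (1 - conj s) = conj (1 - s) by simp [map_sub], completedLFunction_conj hχ1]
  rw [h1, h2, h3]
  -- the functional equation of Mathlib at `1 - s`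
  have hFE : completedLFunction χ s =
      (N : ℂ) ^ ((1 - s) - 1 / 2) * rootNumber χ * completedLFunction χ⁻¹ (1 - s) := by
    have := hprim.completedLFunction_one_sub (1 - s)
    rwa [sub_sub_cancel] at this
  have e2 : (N : ℂ) ^ (s / 2) * (N : ℂ) ^ ((1 - s) - 1 / 2) = (N : ℂ) ^ ((1 - s) / 2) := by
    rw [← cpow_add _ _ hN0]
    congr 1
    ring
  rw [hFE, ← e2]
  ring

end SelbergDirichlet

/-! ### The Selberg datum of a primitive Dirichlet `L`-function; discharge of the named facts -/

open SelbergDirichlet in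
/-- **`L(s, χ) ∈ 𝒮` for a primitive character `χ` mod `N > 1`** — discharge of the named fact
`Literature.NumberTheory.LFunctions.exists_selbergDatum_LFunction`: the Selberg datum has `a(n) = χ(n)`, `F = L(·, χ)`
(Mathlib's `DirichletCharacter.LFunction`), `m = 0`, `Q = (N/π)^{1/2}`, one gamma factor
`Γ(s/2 + κ/2)` (`κ ∈ {0,1}` the parity), `ω = W(χ)` (Mathlib's `rootNumber`, `‖W(χ)‖ = 1` by
`|τ(χ)|² = N`), and `b(n) = χ(n)Λ(n)/log n` (`θ = 0`); degree `2 · (1/2) = 1`, no pole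
(Kaczorowski–Perelli survey §1, Example 2; Davenport, *Multiplicative Number Theory*, Ch. 9).
[cite: KaczorowskiPerelli1999, §1 (examples: Dirichlet L-functions)] -/
theorem exists_selbergDatum_LFunction_holds : exists_selbergDatum_LFunction := by
  intro N _ χ hprim hN
  have hχ1 : χ ≠ 1 := ne_one_of_isPrimitive hN hprim
  obtain ⟨κ, -, hgf⟩ := gammaFactor_shape χ
  obtain ⟨A, B, hAB⟩ := exists_norm_LFunction_le_exp_rpow hprim hN
  have hNpos : (0 : ℝ) < N := by exact_mod_cast Nat.pos_of_ne_zero (NeZero.ne N)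
  have hQpos : 0 < Real.sqrt (N / π) := Real.sqrt_pos.mpr (div_pos hNpos Real.pi_pos)
  refine ⟨{ coeff := fun n ↦ χ n
            toFun := LFunction χ
            polarOrder := 0
            Q := Real.sqrt (N / π)
            numGamma := 1
            lam := fun _ ↦ 1 / 2
            mu := fun _ ↦ (κ : ℂ) / 2
            rootNumber := rootNumber χ
            coeff_one := by simp
            ramanujan := ?_
            eqOn_LSeries := fun s hs ↦ LFunction_eq_LSeries χ hs
            differentiable := ⟨LFunction χ, differentiable_LFunction hχ1, fun s _ ↦ by simp⟩
            finiteOrder := ⟨A, B, fun s _ ↦ by simpa using hAB s⟩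
            Q_pos := hQpos
            lam_pos := fun _ ↦ by norm_num
            mu_re_nonneg := fun _ ↦ by simp; positivity
            norm_rootNumber := norm_rootNumber hprim
            functional_equation := ?_
            euler_product := ?_ }, rfl, ?_, rfl⟩
  · -- Ramanujan: `|χ(n)| ≤ 1 ≤ n^ε` for `n ≥ 1`
    intro ε hε
    refine Asymptotics.IsBigO.of_bound 1 ?_
    filter_upwards [Filter.eventually_ge_atTop 1] with n hn
    rw [one_mul, Real.norm_eq_abs, abs_of_nonneg (by positivity)]
    exact (χ.norm_le_one _).trans (Real.one_le_rpow (by exact_mod_cast hn) hε.le)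
  · -- functional equation
    intro s hs0 hs1
    simp only [Fin.prod_univ_one]
    exact functional_equation_selberg hprim hN κ hgf hs0 hs1
  · -- Euler product
    refine ⟨fun n ↦ χ n * ((ArithmeticFunction.vonMangoldt n / Real.log n : ℝ) : ℂ), 0,
      by norm_num, ?_, ?_, fun s hs ↦ exp_LSeries_vonMangoldt_div_log_eq χ hs⟩
    · intro n hn
      simp [ArithmeticFunction.vonMangoldt_eq_zero_iff.mpr hn]
    · refine Asymptotics.IsBigO.of_bound 1 ?_
      filter_upwards with n
      rw [Real.rpow_zero, norm_one, one_mul, norm_mul]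
      calc ‖χ (n : ZMod N)‖ * ‖((ArithmeticFunction.vonMangoldt n / Real.log n : ℝ) : ℂ)‖
          ≤ 1 * 1 := mul_le_mul (χ.norm_le_one _) (norm_vonMangoldt_div_log_le n)
            (norm_nonneg _) zero_le_one
        _ = 1 := one_mul 1
  · -- degree `2 · (1/2) = 1`
    simp only [SelbergDatum.degree, Finset.univ_unique, Fin.default_eq_zero, Finset.sum_singleton]
    norm_num

/-- **GRH for `𝒮` gives the Riemann hypothesis for primitive Dirichlet `L`-functions** —
discharge of the named fact `Literature.NumberTheory.LFunctions.SelbergGrandRiemannHypothesis.lFunction_re_eq_one_half`: apply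
the Grand Riemann Hypothesis for the Selberg class to the datum of `L(s, χ)`
(`exists_selbergDatum_LFunction_holds`; Kaczorowski–Perelli survey §1). [cite: KaczorowskiPerelli1999, §1 (examples: Dirichlet L-functions)] -/
theorem SelbergGrandRiemannHypothesis.lFunction_re_eq_one_half_holds :
    SelbergGrandRiemannHypothesis.lFunction_re_eq_one_half := by
  intro N _ χ hχ hN hGRH s hs h₀ h₁
  obtain ⟨D, hD, -, -⟩ := exists_selbergDatum_LFunction_holds χ hχ hN
  exact hGRH D s (by rw [hD]; exact hs) h₀ h₁

end Literature.NumberTheory.LFunctions
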